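import Mathlib.MeasureTheory.Measure.Tight
import Mathlib.Topology.MetricSpace.HausdorffDistance
import Mathlib.Topology.ContinuousMap.Bounded.Basic
import Mathlib.MeasureTheory.Integral.Bochner.Basic
import HarnessLib

/-!
# Weak sequential completeness of `P(X)`, `X` Polish — I: finite ball covers and the humps

Topic `MeasureTheory/Radon`; namespace `Literature.MeasureTheory.Radon`.  Preliminaries for the classical
theorem (A. D. Alexandroff 1943; V. S. Varadarajan, *Measures on topological spaces*, Mat. Sb. 55 (1961) =
AMS Transl. (2) 48 (1965), Part II; V. I. Bogachev, *Measure Theory* II (Springer 2007), §8.7 "Weak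
sequential completeness") that on a complete separable metric space a sequence of Borel probability
measures `μₙ` along which `∫ f dμₙ` converges for EVERY bounded continuous `f` is uniformly tight (file
`WeakSequentialCompletenessTight`) and converges weakly to a probability measure (file
`WeakSequentialCompleteness`):

* `exists_finite_measure_compl_biUnion_ball_le` & co — finite ball covers of all but `η` of the mass (Ulam);
* `exists_finite_far_lt_measure_biUnion_ball` — hump extraction;
* `isTightMeasureSet_of_forall_exists_finite_cover` — finite ball covers at every scale ⇒ tight (complete
  spaces: closed totally bounded intersection);
* `exists_humps` — the gliding-hump RECURSION: if finitely many `r`-balls never carry all but `ε` of every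
  `μₙ`, there are indices `n₀ < n₁ < …` and finite sets `G₀, G₁, …`, pairwise `r`-apart, with
  `μ_{n_k}(G_k^{r/8}) > ε/2`, `μ_{n_i}(G_j^{r/4}) ≤ η_j` (`i < j`) and `|∫ Φ(G_i) dμ_{n_j} - L (Φ G_i)| ≤ η_i`
  (`i < j`, `Φ` any assignment of a bounded continuous test function to a set of centres, `L` the limit
  functional).

Everything proved, standard axioms. [folklore]
-/

noncomputable section

open MeasureTheory Filter Topology Set Metric Function
open scoped ENNReal NNReal BoundedContinuousFunction Topology

namespace Literature.MeasureTheory.Radon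

variable {X : Type*} [PseudoMetricSpace X] [MeasurableSpace X] [BorelSpace X]

/-! ### Finite ball covers -/

/-- A finite Borel measure on a complete separable metric space gives all but `η` of its mass to finitely
many `ρ`-balls (Ulam: it is tight; cover a large compact set). [folklore] -/
theorem exists_finite_measure_compl_biUnion_ball_le [CompleteSpace X] [SecondCountableTopology X]
    (μ : Measure X) [IsFiniteMeasure μ] {η : ℝ≥0∞} (hη : 0 < η) {ρ : ℝ} (hρ : 0 < ρ) :
    ∃ C : Set X, C.Finite ∧ μ (⋃ x ∈ C, ball x ρ)ᶜ ≤ η := by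
  obtain ⟨K, hK, hKμ⟩ := (isTightMeasureSet_iff_exists_isCompact_measure_compl_le.1
    (isTightMeasureSet_singleton (μ := μ))) η hη
  obtain ⟨t, -, htfin, hKt⟩ := finite_cover_balls_of_compact hK hρ
  exact ⟨t, htfin, (measure_mono (compl_subset_compl.2 hKt)).trans (hKμ μ rfl)⟩

/-- Finitely many finite Borel measures on a complete separable metric space simultaneously give all but
`η` of their mass to one finite family of `ρ`-balls. [folklore] -/
theorem exists_finite_forall_measure_compl_biUnion_ball_le [CompleteSpace X] [SecondCountableTopology X]
    (μ : ℕ → Measure X) [∀ n, IsFiniteMeasure (μ n)] (T : ℕ) {η : ℝ≥0∞} (hη : 0 < η) {ρ : ℝ}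
    (hρ : 0 < ρ) :
    ∃ C : Set X, C.Finite ∧ ∀ m < T, μ m (⋃ x ∈ C, ball x ρ)ᶜ ≤ η := by
  choose C hCfin hC using fun m => exists_finite_measure_compl_biUnion_ball_le (μ m) hη hρ
  refine ⟨⋃ m ∈ Finset.range T, C m, (Finset.range T).finite_toSet.biUnion fun m _ => hCfin m,
    fun m hm => (measure_mono (compl_subset_compl.2 ?_)).trans (hC m)⟩
  exact biUnion_mono (subset_biUnion_of_mem (Finset.mem_coe.2 (Finset.mem_range.2 hm))) fun _ _ => Subset.rfl

/-- **Hump extraction.**  If the probability measure `μ` gives mass `> ε > 0` to the complement of the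
`r`-balls around the finite set `F`, then some finite set `G`, all of whose points are at distance `≥ r` from
`F`, has `μ`-mass `> ε/2` on its `r/8`-neighbourhood (Ulam tightness of `μ`, a compact part of the complement,
a finite `r/8`-cover centred in it). [folklore] -/
theorem exists_finite_far_lt_measure_biUnion_ball [CompleteSpace X] [SecondCountableTopology X]
    (μ : Measure X) [IsProbabilityMeasure μ] (F : Set X) {ε r : ℝ} (hε : 0 < ε) (hr : 0 < r)
    (hbad : ENNReal.ofReal ε < μ (⋃ x ∈ F, ball x r)ᶜ) :
    ∃ G : Set X, G.Finite ∧ (∀ y ∈ G, ∀ x ∈ F, r ≤ dist y x) ∧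
      ENNReal.ofReal (ε / 2) < μ (⋃ y ∈ G, ball y (r / 8)) := by
  set U : Set X := ⋃ x ∈ F, ball x r with hU
  have hUo : IsOpen U := isOpen_biUnion fun _ _ => isOpen_ball
  obtain ⟨K, hK, hKμ⟩ := (isTightMeasureSet_iff_exists_isCompact_measure_compl_le.1
    (isTightMeasureSet_singleton (μ := μ))) (ENNReal.ofReal (ε / 4)) (ENNReal.ofReal_pos.2 (by positivity))
  have hKμ' : μ Kᶜ ≤ ENNReal.ofReal (ε / 4) := hKμ μ rfl
  set K' : Set X := K ∩ Uᶜ with hK'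
  have hK'c : IsCompact K' := hK.inter_right hUo.isClosed_compl
  -- the compact part of the complement carries mass `> ε/2`
  have hK'μ : ENNReal.ofReal (ε / 2) < μ K' := by
    by_contra hle
    have hle' : μ K' ≤ ENNReal.ofReal (ε / 2) := not_lt.1 hle
    have hsub : Uᶜ ⊆ K' ∪ Kᶜ := by
      intro x hx
      by_cases hxK : x ∈ K
      · exact Or.inl ⟨hxK, hx⟩
      · exact Or.inr hxK
    have h1 : μ Uᶜ ≤ ENNReal.ofReal (ε / 2) + ENNReal.ofReal (ε / 4) :=
      (measure_mono hsub).trans ((measure_union_le _ _).trans (add_le_add hle' hKμ'))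
    rw [← ENNReal.ofReal_add (by positivity) (by positivity)] at h1
    have h2 : ENNReal.ofReal (ε / 2 + ε / 4) < ENNReal.ofReal ε :=
      (ENNReal.ofReal_lt_ofReal_iff hε).2 (by linarith)
    exact (lt_irrefl _) ((hbad.trans_le h1).trans h2)
  obtain ⟨t, htK', htfin, hK't⟩ := finite_cover_balls_of_compact hK'c (by positivity : (0 : ℝ) < r / 8)
  refine ⟨t, htfin, fun y hy x hx => ?_, hK'μ.trans_le (measure_mono hK't)⟩
  have hyU : y ∉ U := (htK' hy).2
  by_contra hlt
  exact hyU (mem_biUnion hx (mem_ball.2 (not_le.1 hlt)))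

/-! ### Finite ball covers at every scale give tightness (complete spaces) -/

omit [BorelSpace X] in
/-- **Finite ball covers at every scale ⇒ tight** (complete pseudo-metric space).  If for every `ε > 0` and
every radius `r > 0` finitely many `r`-balls carry all but `ε` of the mass of every measure of `S`, then `S`
is tight: intersect, over the scales `1/(k+1)`, finite unions of closed balls with defects summing to `ε`;
the intersection is closed and totally bounded, hence compact. [folklore] -/
theorem isTightMeasureSet_of_forall_exists_finite_cover [CompleteSpace X] [OpensMeasurableSpace X]
    {S : Set (Measure X)}
    (h : ∀ ε : ℝ≥0∞, 0 < ε → ∀ r : ℝ, 0 < r →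
      ∃ F : Set X, F.Finite ∧ ∀ μ ∈ S, μ (⋃ x ∈ F, ball x r)ᶜ ≤ ε) :
    IsTightMeasureSet S := by
  rw [isTightMeasureSet_iff_exists_isCompact_measure_compl_le]
  intro ε hε
  obtain ⟨δ, hδpos, hδsum⟩ := ENNReal.exists_pos_sum_of_countable' hε.ne' ℕ
  have hrad : ∀ k : ℕ, (0 : ℝ) < 1 / ((k : ℝ) + 1) := fun k => Nat.one_div_pos_of_nat
  choose F hFfin hF using fun k : ℕ => h (δ k) (hδpos k) (1 / ((k : ℝ) + 1)) (hrad k)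
  set K : Set X := ⋂ k, ⋃ x ∈ F k, closedBall x (1 / ((k : ℝ) + 1)) with hK
  have hKclosed : IsClosed K :=
    isClosed_iInter fun k => (hFfin k).isClosed_biUnion fun _ _ => isClosed_closedBall
  have hKtb : TotallyBounded K := by
    refine Metric.totallyBounded_iff.2 fun r hr => ?_
    obtain ⟨k, hk⟩ := exists_nat_one_div_lt hr
    refine ⟨F k, hFfin k, fun x hx => ?_⟩
    obtain ⟨y, hy, hxy⟩ := mem_iUnion₂.1 (mem_iInter.1 hx k)
    exact mem_biUnion hy (mem_ball.2 ((mem_closedBall.1 hxy).trans_lt hk))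
  have hKc : IsCompact K := isCompact_iff_totallyBounded_isComplete.2 ⟨hKtb, hKclosed.isComplete⟩
  refine ⟨K, hKc, fun μ hμ => ?_⟩
  have hcompl : Kᶜ ⊆ ⋃ k, (⋃ x ∈ F k, ball x (1 / ((k : ℝ) + 1)))ᶜ := by
    intro x hx
    rw [hK, compl_iInter, mem_iUnion] at hx
    obtain ⟨k, hk⟩ := hx
    refine mem_iUnion.2 ⟨k, fun hx' => hk ?_⟩
    obtain ⟨y, hy, hxy⟩ := mem_iUnion₂.1 hx'
    exact mem_biUnion hy (ball_subset_closedBall hxy)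
  calc μ Kᶜ ≤ μ (⋃ k, (⋃ x ∈ F k, ball x (1 / ((k : ℝ) + 1)))ᶜ) := measure_mono hcompl
    _ ≤ ∑' k, μ (⋃ x ∈ F k, ball x (1 / ((k : ℝ) + 1)))ᶜ := measure_iUnion_le _
    _ ≤ ∑' k, δ k := ENNReal.tsum_le_tsum fun k => hF k μ hμ
    _ ≤ ε := hδsum.le

/-! ### The gliding hump -/

/-- **The gliding-hump recursion.**  Let `μₙ` be Borel probability measures on a complete separable metric
space with `∫ f dμₙ → L f` for every bounded continuous `f`, let `Φ` assign a bounded continuous test function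
to every set of centres, and suppose finitely many `r`-balls NEVER carry all but `ε` of the mass of every `μₙ`.
Then there are indices `n₀ < n₁ < …` and nonempty finite sets of centres `G₀, G₁, …`, pairwise `r`-apart, such
that `μ_{n_j}` gives mass `> ε/2` to the `r/8`-neighbourhood of `G_j` (hump), `μ_{n_i}` gives mass `≤ η_j` to the
`r/4`-neighbourhood of `G_j` for `i < j` (later humps are invisible to earlier measures), and
`|∫ Φ(G_i) dμ_{n_j} - L (Φ G_i)| ≤ η_i` for `i < j` (earlier test functions have converged at later indices).
Recursion on states `(n, G, A, T)` (index, centres, accumulated centres, threshold): cover the finitely many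
measures below the threshold by `r/4`-balls up to `η_j`, take a bad index for the enlarged finite set (it is
new), extract a hump far from it (`exists_finite_far_lt_measure_biUnion_ball`), and raise the threshold past
the new index and the convergence index of the new test function. [folklore] -/
theorem exists_humps [CompleteSpace X] [SecondCountableTopology X]
    {μ : ℕ → Measure X} [∀ n, IsProbabilityMeasure (μ n)] {L : (X →ᵇ ℝ) → ℝ}
    (hL : ∀ f : X →ᵇ ℝ, Tendsto (fun n => ∫ x, f x ∂μ n) atTop (𝓝 (L f))) (Φ : Set X → (X →ᵇ ℝ))
    {ε r : ℝ} (hε : 0 < ε) (hr : 0 < r) {η : ℕ → ℝ} (hηpos : ∀ j, 0 < η j) (hηle : ∀ j, η j ≤ ε)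
    (hcon : ∀ F : Set X, F.Finite → ∃ n, ENNReal.ofReal ε < μ n (⋃ x ∈ F, ball x r)ᶜ) :
    ∃ (nn : ℕ → ℕ) (G : ℕ → Set X), StrictMono nn ∧ (∀ j, (G j).Nonempty) ∧
      (∀ i j, i ≠ j → ∀ y ∈ G i, ∀ y' ∈ G j, r ≤ dist y y') ∧
      (∀ j, ENNReal.ofReal (ε / 2) < μ (nn j) (⋃ y ∈ G j, ball y (r / 8))) ∧
      (∀ i j, i < j → μ (nn i) (⋃ y ∈ G j, ball y (r / 4)) ≤ ENNReal.ofReal (η j)) ∧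
      (∀ i j, i < j → |∫ x, Φ (G i) x ∂μ (nn j) - L (Φ (G i))| ≤ η i) := by
  classical
  -- notation for neighbourhoods of a set of centres
  set W : Set X → Set X := fun G => ⋃ y ∈ G, ball y (r / 8) with hW
  set V : Set X → Set X := fun G => ⋃ y ∈ G, ball y (r / 4) with hV
  -- one step of the recursion
  have hstep : ∀ (s : ℕ × Set X × Set X × ℕ) (j : ℕ), s.2.2.1.Finite → ∃ s' : ℕ × Set X × Set X × ℕ,
      s'.2.1.Finite ∧ s'.2.2.1 = s.2.2.1 ∪ s'.2.1 ∧ s.2.2.2 ≤ s'.1 ∧ s'.1 + 1 ≤ s'.2.2.2 ∧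
      s.2.2.2 ≤ s'.2.2.2 ∧
      (∀ y ∈ s'.2.1, ∀ x ∈ s.2.2.1, r ≤ dist y x) ∧
      ENNReal.ofReal (ε / 2) < μ s'.1 (W s'.2.1) ∧
      (∀ m < s.2.2.2, μ m (V s'.2.1) ≤ ENNReal.ofReal (η j)) ∧
      (∀ n, s'.2.2.2 ≤ n → |∫ x, Φ s'.2.1 x ∂μ n - L (Φ s'.2.1)| ≤ η j) := by
    intro s j hA
    obtain ⟨C, hCfin, hC⟩ := exists_finite_forall_measure_compl_biUnion_ball_le μ s.2.2.2
      (ENNReal.ofReal_pos.2 (hηpos j)) (by positivity : (0 : ℝ) < r / 4)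
    obtain ⟨n', hn'⟩ := hcon (s.2.2.1 ∪ C) (hA.union hCfin)
    -- the bad index lies beyond the threshold
    have hTn' : s.2.2.2 ≤ n' := by
      by_contra hlt
      push Not at hlt
      have h1 : μ n' (⋃ x ∈ s.2.2.1 ∪ C, ball x r)ᶜ ≤ μ n' (⋃ x ∈ C, ball x (r / 4))ᶜ := by
        refine measure_mono (compl_subset_compl.2 fun x hx => ?_)
        obtain ⟨c, hc, hxc⟩ := mem_iUnion₂.1 hx
        exact mem_biUnion (Or.inr hc) (ball_subset_ball (by linarith) hxc)
      have h2 := (hn'.trans_le h1).trans_le ((hC n' hlt).trans (ENNReal.ofReal_le_ofReal (hηle j)))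
      exact lt_irrefl _ h2
    obtain ⟨G, hGfin, hGfar, hGμ⟩ :=
      exists_finite_far_lt_measure_biUnion_ball (μ n') (s.2.2.1 ∪ C) hε hr hn'
    obtain ⟨N, hN⟩ := Metric.tendsto_atTop.1 (hL (Φ G)) (η j) (hηpos j)
    refine ⟨⟨n', G, s.2.2.1 ∪ G, max (max s.2.2.2 (n' + 1)) N⟩, hGfin, rfl, hTn', ?_, ?_, ?_, hGμ, ?_, ?_⟩
    · exact (le_max_right _ _).trans (le_max_left _ _)
    · exact (le_max_left _ _).trans (le_max_left _ _)
    · exact fun y hy x hx => hGfar y hy x (Or.inl hx)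
    · intro m hm
      refine (measure_mono ?_).trans (hC m hm)
      intro x hx hx'
      obtain ⟨y, hy, hxy⟩ := mem_iUnion₂.1 hx
      obtain ⟨c, hc, hxc⟩ := mem_iUnion₂.1 hx'
      have hfar := hGfar y hy c (Or.inr hc)
      have htri := dist_triangle y x c
      rw [mem_ball] at hxy hxc
      rw [dist_comm] at hxy
      linarith
    · intro n hn
      have := hN n ((le_max_right _ _).trans hn)
      rw [Real.dist_eq] at this
      exact this.le
  choose! next hnext using hstep
  -- the sequence of states
  set init : ℕ × Set X × Set X × ℕ := (0, ∅, ∅, 0) with hinit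
  set sq : ℕ → ℕ × Set X × Set X × ℕ :=
    fun j => Nat.rec (next init 0) (fun j sj => next sj (j + 1)) j with hsq
  set prev : ℕ → ℕ × Set X × Set X × ℕ := fun j => Nat.rec init (fun i _ => sq i) j with hprev
  have hprev0 : prev 0 = init := rfl
  have hprevs : ∀ j, prev (j + 1) = sq j := fun j => rfl
  have hsq_eq : ∀ j, sq j = next (prev j) j := fun j => by cases j <;> rfl
  have hfinA : ∀ j, (prev j).2.2.1.Finite := by
    intro j
    induction j with
    | zero => exact finite_empty
    | succ j ih =>
      obtain ⟨hG, hA', -⟩ := hnext (prev j) j ih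
      rw [hprevs, hsq_eq, hA']
      exact ih.union hG
  have hspec : ∀ j, (sq j).2.1.Finite ∧ (sq j).2.2.1 = (prev j).2.2.1 ∪ (sq j).2.1 ∧
      (prev j).2.2.2 ≤ (sq j).1 ∧
      (sq j).1 + 1 ≤ (sq j).2.2.2 ∧ (prev j).2.2.2 ≤ (sq j).2.2.2 ∧
      (∀ y ∈ (sq j).2.1, ∀ x ∈ (prev j).2.2.1, r ≤ dist y x) ∧
      ENNReal.ofReal (ε / 2) < μ (sq j).1 (W (sq j).2.1) ∧
      (∀ m < (prev j).2.2.2, μ m (V (sq j).2.1) ≤ ENNReal.ofReal (η j)) ∧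
      (∀ n, (sq j).2.2.2 ≤ n → |∫ x, Φ (sq j).2.1 x ∂μ n - L (Φ (sq j).2.1)| ≤ η j) := by
    intro j
    rw [hsq_eq]
    exact hnext (prev j) j (hfinA j)
  -- abbreviations
  set nn : ℕ → ℕ := fun j => (sq j).1 with hnn
  set G : ℕ → Set X := fun j => (sq j).2.1 with hG
  set ψ : ℕ → X →ᵇ ℝ := fun j => Φ (G j) with hψ
  -- monotonicity of thresholds and indices
  have hTmono : Monotone fun j => (sq j).2.2.2 :=
    monotone_nat_of_le_succ fun j => by
      have := (hspec (j + 1)).2.2.2.2.1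
      rwa [hprevs] at this
  have hn_lt_T : ∀ j, nn j < (sq j).2.2.2 := fun j => (hspec j).2.2.2.1
  have hT_le_n : ∀ j, (sq j).2.2.2 ≤ nn (j + 1) := fun j => by
    have := (hspec (j + 1)).2.2.1
    rwa [hprevs] at this
  have hnmono : StrictMono nn :=
    strictMono_nat_of_lt_succ fun j => (hn_lt_T j).trans_le (hT_le_n j)
  have hn_lt_prevT : ∀ i j, i < j → nn i < (prev j).2.2.2 := by
    intro i j hij
    obtain ⟨k, rfl⟩ := Nat.exists_eq_add_of_lt hij
    rw [show i + k + 1 = (i + k) + 1 from rfl, hprevs]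
    exact (hn_lt_T i).trans_le (hTmono (Nat.le_add_right i k))
  have hT_le_n' : ∀ i j, i < j → (sq i).2.2.2 ≤ nn j := by
    intro i j hij
    obtain ⟨k, rfl⟩ := Nat.exists_eq_add_of_lt hij
    exact (hTmono (Nat.le_add_right i k)).trans (hT_le_n (i + k))
  -- accumulated centres contain all earlier centres
  have hG_sub_prevA : ∀ i j, i < j → G i ⊆ (prev j).2.2.1 := by
    intro i j hij
    induction j with
    | zero => exact absurd hij (Nat.not_lt_zero _)
    | succ j ih =>
      rw [hprevs, (hspec j).2.1]
      rcases Nat.lt_succ_iff_lt_or_eq.1 hij with h' | h'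
      · exact (ih h').trans subset_union_left
      · subst h'; exact subset_union_right
  -- humps are pairwise `r`-apart
  have hfar : ∀ i j, i ≠ j → ∀ y ∈ G i, ∀ y' ∈ G j, r ≤ dist y y' := by
    intro i j hij y hy y' hy'
    rcases lt_or_gt_of_ne hij with h' | h'
    · rw [dist_comm]; exact (hspec j).2.2.2.2.2.1 y' hy' y (hG_sub_prevA i j h' hy)
    · exact (hspec i).2.2.2.2.2.1 y hy y' (hG_sub_prevA j i h' hy')
  have hhump : ∀ j, ENNReal.ofReal (ε / 2) < μ (nn j) (W (G j)) := fun j => (hspec j).2.2.2.2.2.2.1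
  have hinvis : ∀ i j, i < j → μ (nn i) (V (G j)) ≤ ENNReal.ofReal (η j) :=
    fun i j hij => (hspec j).2.2.2.2.2.2.2.1 (nn i) (hn_lt_prevT i j hij)
  have hconv : ∀ i j, i < j → |∫ x, ψ i x ∂μ (nn j) - L (ψ i)| ≤ η i :=
    fun i j hij => (hspec i).2.2.2.2.2.2.2.2 (nn j) (hT_le_n' i j hij)
  have hGne : ∀ j, (G j).Nonempty := by
    intro j
    by_contra hemp
    rw [not_nonempty_iff_eq_empty] at hemp
    have := hhump j
    rw [show W (G j) = ∅ by simp [hW, hemp], measure_empty] at this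
    exact absurd this (not_lt.2 bot_le)
  exact ⟨nn, G, hnmono, hGne, hfar, hhump, hinvis, hconv⟩

end Literature.MeasureTheory.Radon

end
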